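import Summits.Ventures.LatticeQCDFlow.Exactness.IMHCommonRandomNumbersMeetingTimeSharp
import HarnessLib

/-!
# The meeting time of two coupled flow-MCMC runs as a random variable: the TOTAL disagreement time `T = #{n : X_n ≠ X′_n}` is
# almost surely finite with `E[T] = Σ_n P(X_n ≠ X′_n) ≤ P(X_0 ≠ X′_0)·W`, `E[T²] ≤ P(X_0 ≠ X′_0)·W(2W − 1)`,
# `P(T ≥ t) ≤ (1 − A)^{t−1}·P(X_0 ≠ X′_0)`, and from (cold, off-mode) `E[T] = W`, `E[T²] = W(2W − 1)` exactly

HONEST FRAMING: exact (Metropolis-corrected) sampling algorithms for lattice gauge theory;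
figures of merit are autocorrelation/cost numbers at stated couplings and volumes; no
continuum-physics claim.

Venture `LatticeQCDFlow` (cell pub-lqcd), topic `Exactness`; FANOUT row 30 (lean-1, GEN-38).  NEW WORK of the cell,
general state space with `MeasurableEq Ω`; sequel to this generation's `…MergedForever` (a.s. the runs coincide forever from some
time on), `…MeetingTimeLaw` (for the truncated counts `T_M = #{n < M : X_n ≠ X′_n}`: geometric tail, `E[T_M²] ≤ P(X_0 ≠ X′_0)·W(2W − 1)`
uniformly in `M`) and `…MeetingTimeSharp` (from (cold, off-mode): `E[T_M] → W`, `E[T_M²] → W(2W − 1)`), and to GEN-37's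
`…MeetingTime` (`E[T_M] ≤ P(X_0 ≠ X′_0)·W`).  Here the horizon `M` is removed: the total disagreement time
`T(z) = Σ_{n≥0} 1{z_n ∉ Δ}` (Mathlib's `tsum` along the pair path; on almost every path a finite sum and, since merged runs stay
merged, the MEETING TIME itself) is treated as a random variable on the pair path law `P̂_{μ̂₀}` of the CRN pair kernel of
`K = indepMH q w` (`W = w(x₀)`, `r = 1 − 1/W`):

* §1 **`crn_chain_ae_summable_disagreement`** — a.s. the indicators are eventually zero, so `T` is a finite sum;
  **`crn_chain_ae_tendsto_disagreementCount`** — `T_M ↑ T` along almost every path.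
* §2 **`crn_chain_integral_totalDisagreement_eq`** — `E[T] = Σ_{n≥0} P(X_n ≠ X′_n)` (the series converges: terms `≤ rⁿ·P(X_0 ≠ X′_0)`);
  **`crn_chain_integral_totalDisagreement_le`** — `E[T] ≤ P(X_0 ≠ X′_0)·W` from every initial coupling.
* §3 **`crn_chain_totalDisagreement_sq_integrable`**, **`crn_chain_integral_totalDisagreement_sq_le`** — `T ∈ L²` with
  `E[T²] ≤ P(X_0 ≠ X′_0)·W(2W − 1)` (Fatou along `T_M ↑ T`).
* §4 **`crn_chain_totalDisagreement_tail_le`** — `P(T ≥ t) ≤ r^{t−1}·P(X_0 ≠ X′_0)` for every `t ≥ 1`.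
* §5 (cold, off-mode; atom-free proposal) **`crn_chain_integral_totalDisagreement_eq_cold`** — `E[T] = W` EXACTLY and
  **`crn_chain_integral_totalDisagreement_sq_eq_cold`** — `E[T²] = W(2W − 1)` EXACTLY (monotone convergence), so
  `Var T = W(2W − 1) − W² = W(W − 1)`: the geometric law with success probability `A`.
Reading (gauge files): the number of updates during which two exact gauge samplers on one stream of random numbers differ is an
almost surely finite random variable with mean `≤ 1/A` and second moment `≤ (1/A)(2/A − 1)` (times the probability that they start
different), equalities from (cold, hot).
NOT CLAIMED: the law of `T` for two non-modal starts beyond these bounds; exponential moments; any value of `A`.  No `sorry`, no new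
definitions, nothing cited as a fact.
-/

noncomputable section

namespace Summit.Ventures.LatticeQCDFlow.Exactness

open MeasureTheory ProbabilityTheory Function Finset Filter
open scoped ENNReal unitInterval Topology
open Summit.Ventures.LatticeQCDFlow.Scoring

variable {Ω : Type*} [MeasurableSpace Ω] {q : Measure Ω} [IsProbabilityMeasure q] {w : Ω → ℝ}

/-! ## §1 `T` is a finite sum on almost every pair path, the monotone limit of the truncated counts -/

/-- **ALMOST SURELY THE DISAGREEMENT INDICATORS ARE EVENTUALLY ZERO**, so `n ↦ 1{z_n ∉ Δ}` is summable on a.e. path. [ours] -/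
theorem crn_chain_ae_summable_disagreement [MeasurableEq Ω] (hw : Measurable w) (hw0 : ∀ y, 0 < w y) {x₀ : Ω}
    (hmax : ∀ y, w y ≤ w x₀) [IsProbabilityMeasure (q.withDensity fun y => ENNReal.ofReal (w y))]
    (Khat : Kernel (Ω × Ω) (Ω × Ω)) [IsMarkovKernel Khat]
    (hK : ∀ z : Ω × Ω, Khat z = (q.prod (volume : Measure unitInterval)).map (fun p : Ω × unitInterval =>
      ((if (p.2 : ℝ) * w z.1 ≤ w p.1 then p.1 else z.1), (if (p.2 : ℝ) * w z.2 ≤ w p.1 then p.1 else z.2))))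
    (μ₀ : Measure (Ω × Ω)) [IsProbabilityMeasure μ₀] :
    ∀ᵐ z ∂(Kernel.trajMeasure (X := fun _ : ℕ => Ω × Ω) μ₀
        (fun n : ℕ => Khat.comap (fun h : (i : ↥(Finset.Iic n)) → Ω × Ω => h ⟨n, Finset.mem_Iic.2 le_rfl⟩)
          (measurable_pi_apply _))),
      (∃ n₀, ∀ n, n₀ ≤ n → ((Set.diagonal Ω)ᶜ).indicator (1 : Ω × Ω → ℝ) (z n) = 0) ∧
        Summable (fun n => ((Set.diagonal Ω)ᶜ).indicator (1 : Ω × Ω → ℝ) (z n)) := by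
  filter_upwards [crn_chain_ae_eventually_merged hw hw0 hmax Khat hK μ₀] with z hz
  obtain ⟨n₀, hn₀⟩ := hz
  have hzero : ∀ n, n₀ ≤ n → ((Set.diagonal Ω)ᶜ).indicator (1 : Ω × Ω → ℝ) (z n) = 0 := fun n hn =>
    Set.indicator_of_notMem (show z n ∉ (Set.diagonal Ω)ᶜ from fun h => h (Set.mem_diagonal_iff.2 (hn₀ n hn))) _
  refine ⟨⟨n₀, hzero⟩, summable_of_ne_finset_zero (s := Finset.range n₀) fun n hn => ?_⟩
  exact hzero n (Nat.le_of_not_lt fun h => hn (Finset.mem_range.2 h))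

/-- **`T_M ↑ T` ALONG ALMOST EVERY PATH**: the truncated counts are monotone and converge to the total disagreement time. [ours] -/
theorem crn_chain_ae_tendsto_disagreementCount [MeasurableEq Ω] (hw : Measurable w) (hw0 : ∀ y, 0 < w y) {x₀ : Ω}
    (hmax : ∀ y, w y ≤ w x₀) [IsProbabilityMeasure (q.withDensity fun y => ENNReal.ofReal (w y))]
    (Khat : Kernel (Ω × Ω) (Ω × Ω)) [IsMarkovKernel Khat]
    (hK : ∀ z : Ω × Ω, Khat z = (q.prod (volume : Measure unitInterval)).map (fun p : Ω × unitInterval =>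
      ((if (p.2 : ℝ) * w z.1 ≤ w p.1 then p.1 else z.1), (if (p.2 : ℝ) * w z.2 ≤ w p.1 then p.1 else z.2))))
    (μ₀ : Measure (Ω × Ω)) [IsProbabilityMeasure μ₀] :
    ∀ᵐ z ∂(Kernel.trajMeasure (X := fun _ : ℕ => Ω × Ω) μ₀
        (fun n : ℕ => Khat.comap (fun h : (i : ↥(Finset.Iic n)) → Ω × Ω => h ⟨n, Finset.mem_Iic.2 le_rfl⟩)
          (measurable_pi_apply _))),
      Monotone (fun M => ∑ n ∈ Finset.range M, ((Set.diagonal Ω)ᶜ).indicator (1 : Ω × Ω → ℝ) (z n)) ∧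
      Tendsto (fun M => ∑ n ∈ Finset.range M, ((Set.diagonal Ω)ᶜ).indicator (1 : Ω × Ω → ℝ) (z n)) atTop
        (𝓝 (∑' n, ((Set.diagonal Ω)ᶜ).indicator (1 : Ω × Ω → ℝ) (z n))) := by
  filter_upwards [crn_chain_ae_summable_disagreement hw hw0 hmax Khat hK μ₀] with z hz
  exact ⟨monotone_nat_of_le_succ fun M => by
      rw [Finset.sum_range_succ]
      exact le_add_of_nonneg_right (Set.indicator_nonneg (fun _ _ => zero_le_one) _),
    hz.2.hasSum.tendsto_sum_nat⟩

/-! ## §2 The expectation of the total disagreement time -/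

/-- **`E[T] = Σ_{n≥0} P(X_n ≠ X′_n)`** from every initial coupling (`w` normalised, maximal at `x₀`): the series of one-time
disagreement probabilities converges (terms `≤ rⁿ·P(X_0 ≠ X′_0)`) and sums to the expected total disagreement time. [ours] -/
theorem crn_chain_integral_totalDisagreement_eq [MeasurableEq Ω] (hw : Measurable w) (hw0 : ∀ y, 0 < w y) {x₀ : Ω}
    (hmax : ∀ y, w y ≤ w x₀) [IsProbabilityMeasure (q.withDensity fun y => ENNReal.ofReal (w y))]
    (Khat : Kernel (Ω × Ω) (Ω × Ω)) [IsMarkovKernel Khat]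
    (hK : ∀ z : Ω × Ω, Khat z = (q.prod (volume : Measure unitInterval)).map (fun p : Ω × unitInterval =>
      ((if (p.2 : ℝ) * w z.1 ≤ w p.1 then p.1 else z.1), (if (p.2 : ℝ) * w z.2 ≤ w p.1 then p.1 else z.2))))
    (μ₀ : Measure (Ω × Ω)) [IsProbabilityMeasure μ₀] :
    Summable (fun n => ((fun m : Measure (Ω × Ω) => m.bind Khat)^[n] μ₀).real (Set.diagonal Ω)ᶜ) ∧
    ∫ z, (∑' n, ((Set.diagonal Ω)ᶜ).indicator (1 : Ω × Ω → ℝ) (z n))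
        ∂(Kernel.trajMeasure (X := fun _ : ℕ => Ω × Ω) μ₀
          (fun n : ℕ => Khat.comap (fun h : (i : ↥(Finset.Iic n)) → Ω × Ω => h ⟨n, Finset.mem_Iic.2 le_rfl⟩)
            (measurable_pi_apply _))) =
      ∑' n, ((fun m : Measure (Ω × Ω) => m.bind Khat)^[n] μ₀).real (Set.diagonal Ω)ᶜ := by
  set P := Kernel.trajMeasure (X := fun _ : ℕ => Ω × Ω) μ₀
      (fun n : ℕ => Khat.comap (fun h : (i : ↥(Finset.Iic n)) → Ω × Ω => h ⟨n, Finset.mem_Iic.2 le_rfl⟩)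
        (measurable_pi_apply _)) with hP
  have hW : 1 ≤ w x₀ := one_le_of_mode (q := q) hmax
  have hWpos : 0 < w x₀ := hw0 x₀
  have hr0 : 0 ≤ 1 - (w x₀)⁻¹ := sub_nonneg.2 (inv_le_one_of_one_le₀ hW)
  have hr1 : 1 - (w x₀)⁻¹ < 1 := sub_lt_self _ (inv_pos.2 hWpos)
  have hD : MeasurableSet (Set.diagonal Ω) := measurableSet_diagonal
  have hIm : Measurable ((Set.diagonal Ω)ᶜ.indicator (1 : Ω × Ω → ℝ)) := measurable_one.indicator hD.compl
  have hIb : ∀ p : Ω × Ω, |(Set.diagonal Ω)ᶜ.indicator (1 : Ω × Ω → ℝ) p| ≤ 1 := by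
    intro p
    by_cases hp : p ∈ (Set.diagonal Ω)ᶜ
    · rw [Set.indicator_of_mem hp, Pi.one_apply, abs_one]
    · rw [Set.indicator_of_notMem hp, abs_zero]; exact zero_le_one
  have hInn : ∀ p : Ω × Ω, 0 ≤ (Set.diagonal Ω)ᶜ.indicator (1 : Ω × Ω → ℝ) p := fun p =>
    Set.indicator_nonneg (fun _ _ => zero_le_one) _
  have hIi : ∀ n, Integrable (fun z : ℕ → Ω × Ω => (Set.diagonal Ω)ᶜ.indicator (1 : Ω × Ω → ℝ) (z n)) P := fun n =>
    integrable_of_bounded P (hIm.comp (measurable_pi_apply n)) (fun z => hIb _)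
  have hterm : ∀ n, ∫ z, (Set.diagonal Ω)ᶜ.indicator (1 : Ω × Ω → ℝ) (z n) ∂P =
      ((fun m : Measure (Ω × Ω) => m.bind Khat)^[n] μ₀).real (Set.diagonal Ω)ᶜ := by
    intro n
    rw [hP, chain_expect_eq_integral_iterate_bind Khat μ₀ hIm hIb n, integral_indicator_one hD.compl]
  have hnorm : ∀ n, ∫ z, ‖(Set.diagonal Ω)ᶜ.indicator (1 : Ω × Ω → ℝ) (z n)‖ ∂P =
      ((fun m : Measure (Ω × Ω) => m.bind Khat)^[n] μ₀).real (Set.diagonal Ω)ᶜ := by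
    intro n
    rw [← hterm n]
    exact integral_congr_ae (ae_of_all _ fun z => by dsimp only; rw [Real.norm_eq_abs, abs_of_nonneg (hInn _)])
  -- summability by comparison with the geometric envelope
  have hsum : Summable (fun n => ((fun m : Measure (Ω × Ω) => m.bind Khat)^[n] μ₀).real (Set.diagonal Ω)ᶜ) := by
    refine Summable.of_nonneg_of_le (fun n => measureReal_nonneg)
      (fun n => iterate_bind_crnPair_offDiagonal_le hw hw0 hmax Khat hK n μ₀) ?_
    exact (summable_geometric_of_lt_one hr0 hr1).mul_right _
  refine ⟨hsum, ?_⟩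
  have hsum' : Summable (fun n => ∫ z, ‖(Set.diagonal Ω)ᶜ.indicator (1 : Ω × Ω → ℝ) (z n)‖ ∂P) := by
    simp_rw [hnorm]; exact hsum
  rw [← integral_tsum_of_summable_integral_norm hIi hsum']
  exact tsum_congr hterm

/-- **`E[T] ≤ P(X_0 ≠ X′_0)·W`**: the expected TOTAL disagreement time from every initial coupling. [ours] -/
theorem crn_chain_integral_totalDisagreement_le [MeasurableEq Ω] (hw : Measurable w) (hw0 : ∀ y, 0 < w y) {x₀ : Ω}
    (hmax : ∀ y, w y ≤ w x₀) [IsProbabilityMeasure (q.withDensity fun y => ENNReal.ofReal (w y))]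
    (Khat : Kernel (Ω × Ω) (Ω × Ω)) [IsMarkovKernel Khat]
    (hK : ∀ z : Ω × Ω, Khat z = (q.prod (volume : Measure unitInterval)).map (fun p : Ω × unitInterval =>
      ((if (p.2 : ℝ) * w z.1 ≤ w p.1 then p.1 else z.1), (if (p.2 : ℝ) * w z.2 ≤ w p.1 then p.1 else z.2))))
    (μ₀ : Measure (Ω × Ω)) [IsProbabilityMeasure μ₀] :
    ∫ z, (∑' n, ((Set.diagonal Ω)ᶜ).indicator (1 : Ω × Ω → ℝ) (z n))
        ∂(Kernel.trajMeasure (X := fun _ : ℕ => Ω × Ω) μ₀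
          (fun n : ℕ => Khat.comap (fun h : (i : ↥(Finset.Iic n)) → Ω × Ω => h ⟨n, Finset.mem_Iic.2 le_rfl⟩)
            (measurable_pi_apply _))) ≤ μ₀.real (Set.diagonal Ω)ᶜ * w x₀ := by
  have hW : 1 ≤ w x₀ := one_le_of_mode (q := q) hmax
  have hWpos : 0 < w x₀ := hw0 x₀
  have hr0 : 0 ≤ 1 - (w x₀)⁻¹ := sub_nonneg.2 (inv_le_one_of_one_le₀ hW)
  have hr1 : 1 - (w x₀)⁻¹ < 1 := sub_lt_self _ (inv_pos.2 hWpos)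
  obtain ⟨hsum, heq⟩ := crn_chain_integral_totalDisagreement_eq hw hw0 hmax Khat hK μ₀
  rw [heq]
  have hgeo := (hasSum_geometric_of_lt_one hr0 hr1).mul_right (μ₀.real (Set.diagonal Ω)ᶜ)
  have hlim : (1 - (1 - (w x₀)⁻¹))⁻¹ * μ₀.real (Set.diagonal Ω)ᶜ = μ₀.real (Set.diagonal Ω)ᶜ * w x₀ := by
    rw [sub_sub_cancel, inv_inv, mul_comm]
  rw [← hlim, ← hgeo.tsum_eq]
  exact hsum.tsum_le_tsum (fun n => iterate_bind_crnPair_offDiagonal_le hw hw0 hmax Khat hK n μ₀) hgeo.summable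

/-! ## §3 The second moment of the total disagreement time (Fatou) -/

/-- **`∫⁻ T² ≤ P(X_0 ≠ X′_0)·W(2W − 1)`** (extended-real form, Fatou along `T_M ↑ T`). [ours] -/
theorem crn_chain_lintegral_totalDisagreement_sq_le [MeasurableEq Ω] [Fact (Measurable w)] (hw0 : ∀ y, 0 < w y) {x₀ : Ω}
    (hmax : ∀ y, w y ≤ w x₀) [IsProbabilityMeasure (q.withDensity fun y => ENNReal.ofReal (w y))]
    (Khat : Kernel (Ω × Ω) (Ω × Ω)) [IsMarkovKernel Khat]
    (hK : ∀ z : Ω × Ω, Khat z = (q.prod (volume : Measure unitInterval)).map (fun p : Ω × unitInterval =>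
      ((if (p.2 : ℝ) * w z.1 ≤ w p.1 then p.1 else z.1), (if (p.2 : ℝ) * w z.2 ≤ w p.1 then p.1 else z.2))))
    (μ₀ : Measure (Ω × Ω)) [IsProbabilityMeasure μ₀] :
    ∫⁻ z, ENNReal.ofReal ((∑' n, ((Set.diagonal Ω)ᶜ).indicator (1 : Ω × Ω → ℝ) (z n)) ^ 2)
        ∂(Kernel.trajMeasure (X := fun _ : ℕ => Ω × Ω) μ₀
          (fun n : ℕ => Khat.comap (fun h : (i : ↥(Finset.Iic n)) → Ω × Ω => h ⟨n, Finset.mem_Iic.2 le_rfl⟩)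
            (measurable_pi_apply _))) ≤ ENNReal.ofReal (μ₀.real (Set.diagonal Ω)ᶜ * (w x₀ * (2 * w x₀ - 1))) := by
  set P := Kernel.trajMeasure (X := fun _ : ℕ => Ω × Ω) μ₀
      (fun n : ℕ => Khat.comap (fun h : (i : ↥(Finset.Iic n)) → Ω × Ω => h ⟨n, Finset.mem_Iic.2 le_rfl⟩)
        (measurable_pi_apply _)) with hP
  have hw : Measurable w := Fact.out
  have hD : MeasurableSet (Set.diagonal Ω) := measurableSet_diagonal
  have hIm : Measurable ((Set.diagonal Ω)ᶜ.indicator (1 : Ω × Ω → ℝ)) := measurable_one.indicator hD.compl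
  have hTm : ∀ M, Measurable fun z : ℕ → Ω × Ω =>
      (∑ n ∈ Finset.range M, ((Set.diagonal Ω)ᶜ).indicator (1 : Ω × Ω → ℝ) (z n)) ^ 2 := fun M =>
    (Finset.measurable_sum _ fun n _ => hIm.comp (measurable_pi_apply n)).pow_const 2
  have hTnn : ∀ M (z : ℕ → Ω × Ω), 0 ≤ ∑ n ∈ Finset.range M, ((Set.diagonal Ω)ᶜ).indicator (1 : Ω × Ω → ℝ) (z n) :=
    fun M z => sum_nonneg fun n _ => Set.indicator_nonneg (fun _ _ => zero_le_one) _
  have hTle : ∀ M (z : ℕ → Ω × Ω), ∑ n ∈ Finset.range M, ((Set.diagonal Ω)ᶜ).indicator (1 : Ω × Ω → ℝ) (z n) ≤ M :=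
    fun M z => calc ∑ n ∈ Finset.range M, ((Set.diagonal Ω)ᶜ).indicator (1 : Ω × Ω → ℝ) (z n)
        ≤ ∑ n ∈ Finset.range M, (1 : ℝ) := sum_le_sum fun n _ => Set.indicator_le_self' (fun _ _ => zero_le_one) _
      _ = M := by rw [sum_const, card_range, nsmul_eq_mul, mul_one]
  have hTi : ∀ M, Integrable (fun z : ℕ → Ω × Ω =>
      (∑ n ∈ Finset.range M, ((Set.diagonal Ω)ᶜ).indicator (1 : Ω × Ω → ℝ) (z n)) ^ 2) P := fun M =>
    integrable_of_bounded P (hTm M) (C := (M : ℝ) ^ 2) (fun z => by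
      rw [abs_of_nonneg (sq_nonneg _)]; exact pow_le_pow_left₀ (hTnn M z) (hTle M z) 2)
  have hbound : ∀ M, ∫ z, (∑ n ∈ Finset.range M, ((Set.diagonal Ω)ᶜ).indicator (1 : Ω × Ω → ℝ) (z n)) ^ 2 ∂P ≤
      μ₀.real (Set.diagonal Ω)ᶜ * (w x₀ * (2 * w x₀ - 1)) := fun M =>
    crn_chain_integral_disagreementCount_sq_le hw0 hmax Khat hK μ₀ M
  have hae : ∀ᵐ z ∂P, ENNReal.ofReal ((∑' n, ((Set.diagonal Ω)ᶜ).indicator (1 : Ω × Ω → ℝ) (z n)) ^ 2) =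
      liminf (fun M => ENNReal.ofReal
        ((∑ n ∈ Finset.range M, ((Set.diagonal Ω)ᶜ).indicator (1 : Ω × Ω → ℝ) (z n)) ^ 2)) atTop := by
    filter_upwards [crn_chain_ae_tendsto_disagreementCount hw hw0 hmax Khat hK μ₀] with z hz
    exact ((ENNReal.continuous_ofReal.tendsto _).comp (hz.2.pow 2)).liminf_eq.symm
  rw [lintegral_congr_ae hae]
  refine (lintegral_liminf_le fun M => ENNReal.measurable_ofReal.comp (hTm M)).trans ?_
  refine liminf_le_of_frequently_le' (Frequently.of_forall fun M => ?_)
  show ∫⁻ z, ENNReal.ofReal ((∑ n ∈ Finset.range M, ((Set.diagonal Ω)ᶜ).indicator (1 : Ω × Ω → ℝ) (z n)) ^ 2) ∂P ≤ _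
  rw [← ofReal_integral_eq_lintegral_ofReal (hTi M) (ae_of_all _ fun z => sq_nonneg _)]
  exact ENNReal.ofReal_le_ofReal (hbound M)

/-- **`T ∈ L²`**: the square of the total disagreement time is integrable, from every initial coupling. [ours] -/
theorem crn_chain_totalDisagreement_sq_integrable [MeasurableEq Ω] [Fact (Measurable w)] (hw0 : ∀ y, 0 < w y) {x₀ : Ω}
    (hmax : ∀ y, w y ≤ w x₀) [IsProbabilityMeasure (q.withDensity fun y => ENNReal.ofReal (w y))]
    (Khat : Kernel (Ω × Ω) (Ω × Ω)) [IsMarkovKernel Khat]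
    (hK : ∀ z : Ω × Ω, Khat z = (q.prod (volume : Measure unitInterval)).map (fun p : Ω × unitInterval =>
      ((if (p.2 : ℝ) * w z.1 ≤ w p.1 then p.1 else z.1), (if (p.2 : ℝ) * w z.2 ≤ w p.1 then p.1 else z.2))))
    (μ₀ : Measure (Ω × Ω)) [IsProbabilityMeasure μ₀] :
    Integrable (fun z : ℕ → Ω × Ω => (∑' n, ((Set.diagonal Ω)ᶜ).indicator (1 : Ω × Ω → ℝ) (z n)) ^ 2)
      (Kernel.trajMeasure (X := fun _ : ℕ => Ω × Ω) μ₀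
        (fun n : ℕ => Khat.comap (fun h : (i : ↥(Finset.Iic n)) → Ω × Ω => h ⟨n, Finset.mem_Iic.2 le_rfl⟩)
          (measurable_pi_apply _))) := by
  have hw : Measurable w := Fact.out
  have hD : MeasurableSet (Set.diagonal Ω) := measurableSet_diagonal
  have hIm : Measurable ((Set.diagonal Ω)ᶜ.indicator (1 : Ω × Ω → ℝ)) := measurable_one.indicator hD.compl
  have hTm : ∀ M, Measurable fun z : ℕ → Ω × Ω =>
      (∑ n ∈ Finset.range M, ((Set.diagonal Ω)ᶜ).indicator (1 : Ω × Ω → ℝ) (z n)) ^ 2 := fun M =>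
    (Finset.measurable_sum _ fun n _ => hIm.comp (measurable_pi_apply n)).pow_const 2
  have hasm : AEStronglyMeasurable (fun z : ℕ → Ω × Ω => (∑' n, ((Set.diagonal Ω)ᶜ).indicator (1 : Ω × Ω → ℝ) (z n)) ^ 2)
      (Kernel.trajMeasure (X := fun _ : ℕ => Ω × Ω) μ₀
        (fun n : ℕ => Khat.comap (fun h : (i : ↥(Finset.Iic n)) → Ω × Ω => h ⟨n, Finset.mem_Iic.2 le_rfl⟩)
          (measurable_pi_apply _))) :=
    aestronglyMeasurable_of_tendsto_ae atTop (fun M => (hTm M).aestronglyMeasurable) (by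
      filter_upwards [crn_chain_ae_tendsto_disagreementCount hw hw0 hmax Khat hK μ₀] with z hz
      exact hz.2.pow 2)
  refine ⟨hasm, ?_⟩
  rw [hasFiniteIntegral_iff_ofReal (ae_of_all _ fun z => sq_nonneg _)]
  exact (crn_chain_lintegral_totalDisagreement_sq_le hw0 hmax Khat hK μ₀).trans_lt ENNReal.ofReal_lt_top

/-- **`E[T²] ≤ P(X_0 ≠ X′_0)·W(2W − 1)`** for the total disagreement time, from every initial coupling. [ours] -/
theorem crn_chain_integral_totalDisagreement_sq_le [MeasurableEq Ω] [Fact (Measurable w)] (hw0 : ∀ y, 0 < w y) {x₀ : Ω}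
    (hmax : ∀ y, w y ≤ w x₀) [IsProbabilityMeasure (q.withDensity fun y => ENNReal.ofReal (w y))]
    (Khat : Kernel (Ω × Ω) (Ω × Ω)) [IsMarkovKernel Khat]
    (hK : ∀ z : Ω × Ω, Khat z = (q.prod (volume : Measure unitInterval)).map (fun p : Ω × unitInterval =>
      ((if (p.2 : ℝ) * w z.1 ≤ w p.1 then p.1 else z.1), (if (p.2 : ℝ) * w z.2 ≤ w p.1 then p.1 else z.2))))
    (μ₀ : Measure (Ω × Ω)) [IsProbabilityMeasure μ₀] :
    ∫ z, (∑' n, ((Set.diagonal Ω)ᶜ).indicator (1 : Ω × Ω → ℝ) (z n)) ^ 2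
        ∂(Kernel.trajMeasure (X := fun _ : ℕ => Ω × Ω) μ₀
          (fun n : ℕ => Khat.comap (fun h : (i : ↥(Finset.Iic n)) → Ω × Ω => h ⟨n, Finset.mem_Iic.2 le_rfl⟩)
            (measurable_pi_apply _))) ≤ μ₀.real (Set.diagonal Ω)ᶜ * (w x₀ * (2 * w x₀ - 1)) := by
  have hW : 1 ≤ w x₀ := one_le_of_mode (q := q) hmax
  have hB0 : 0 ≤ μ₀.real (Set.diagonal Ω)ᶜ * (w x₀ * (2 * w x₀ - 1)) :=
    mul_nonneg measureReal_nonneg (mul_nonneg (by linarith) (by linarith))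
  have hI := crn_chain_totalDisagreement_sq_integrable hw0 hmax Khat hK μ₀
  have hL := crn_chain_lintegral_totalDisagreement_sq_le hw0 hmax Khat hK μ₀
  rw [integral_eq_lintegral_of_nonneg_ae (ae_of_all _ fun z => sq_nonneg _) hI.aestronglyMeasurable]
  exact (ENNReal.toReal_mono ENNReal.ofReal_ne_top hL).trans_eq (ENNReal.toReal_ofReal hB0)

/-! ## §4 The tail of the total disagreement time -/

/-- **`P(T ≥ t) ≤ r^{t−1}·P(X_0 ≠ X′_0)`** for every `t ≥ 1`, from every initial coupling. [ours] -/
theorem crn_chain_totalDisagreement_tail_le [MeasurableEq Ω] (hw : Measurable w) (hw0 : ∀ y, 0 < w y) {x₀ : Ω}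
    (hmax : ∀ y, w y ≤ w x₀) [IsProbabilityMeasure (q.withDensity fun y => ENNReal.ofReal (w y))]
    (Khat : Kernel (Ω × Ω) (Ω × Ω)) [IsMarkovKernel Khat]
    (hK : ∀ z : Ω × Ω, Khat z = (q.prod (volume : Measure unitInterval)).map (fun p : Ω × unitInterval =>
      ((if (p.2 : ℝ) * w z.1 ≤ w p.1 then p.1 else z.1), (if (p.2 : ℝ) * w z.2 ≤ w p.1 then p.1 else z.2))))
    (μ₀ : Measure (Ω × Ω)) [IsProbabilityMeasure μ₀] {t : ℕ} (ht : 1 ≤ t) :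
    (Kernel.trajMeasure (X := fun _ : ℕ => Ω × Ω) μ₀
          (fun n : ℕ => Khat.comap (fun h : (i : ↥(Finset.Iic n)) → Ω × Ω => h ⟨n, Finset.mem_Iic.2 le_rfl⟩)
            (measurable_pi_apply _))).real
        {z | (t : ℝ) ≤ ∑' n, ((Set.diagonal Ω)ᶜ).indicator (1 : Ω × Ω → ℝ) (z n)} ≤
      (1 - (w x₀)⁻¹) ^ (t - 1) * μ₀.real (Set.diagonal Ω)ᶜ := by
  set P := Kernel.trajMeasure (X := fun _ : ℕ => Ω × Ω) μ₀
      (fun n : ℕ => Khat.comap (fun h : (i : ↥(Finset.Iic n)) → Ω × Ω => h ⟨n, Finset.mem_Iic.2 le_rfl⟩)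
        (measurable_pi_apply _)) with hP
  -- a.e.: if the runs agree at time `t − 1` they agree ever after, so `T ≤ t − 1 < t`
  have hsub : P {z | (t : ℝ) ≤ ∑' n, ((Set.diagonal Ω)ᶜ).indicator (1 : Ω × Ω → ℝ) (z n)} ≤
      P {z | z (t - 1) ∉ Set.diagonal Ω} := by
    refine measure_mono_ae ?_
    filter_upwards [crn_chain_ae_merged_stay hw hw0 Khat hK μ₀, crn_chain_ae_summable_disagreement hw hw0 hmax Khat hK μ₀]
      with z hz hsumz
    intro hT hmem
    -- every indicator with index `≥ t − 1` vanishes: the `tsum` is a sum over `range (t − 1)`, at most `t − 1`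
    have hzero : ∀ n, n ∉ Finset.range (t - 1) → ((Set.diagonal Ω)ᶜ).indicator (1 : Ω × Ω → ℝ) (z n) = 0 := by
      intro n hn
      have hle : t - 1 ≤ n := Nat.le_of_not_lt fun h => hn (Finset.mem_range.2 h)
      exact Set.indicator_of_notMem (show z n ∉ (Set.diagonal Ω)ᶜ from fun h => h (hz (t - 1) n hle hmem)) _
    have hts : ∑' n, ((Set.diagonal Ω)ᶜ).indicator (1 : Ω × Ω → ℝ) (z n) =
        ∑ n ∈ Finset.range (t - 1), ((Set.diagonal Ω)ᶜ).indicator (1 : Ω × Ω → ℝ) (z n) := tsum_eq_sum hzero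
    have hle : ∑ n ∈ Finset.range (t - 1), ((Set.diagonal Ω)ᶜ).indicator (1 : Ω × Ω → ℝ) (z n) ≤ (t - 1 : ℕ) :=
      calc ∑ n ∈ Finset.range (t - 1), ((Set.diagonal Ω)ᶜ).indicator (1 : Ω × Ω → ℝ) (z n)
          ≤ ∑ n ∈ Finset.range (t - 1), (1 : ℝ) := sum_le_sum fun n _ => Set.indicator_le_self' (fun _ _ => zero_le_one) _
        _ = (t - 1 : ℕ) := by rw [sum_const, card_range, nsmul_eq_mul, mul_one]
    have hcast : ((t - 1 : ℕ) : ℝ) = (t : ℝ) - 1 := by rw [Nat.cast_sub ht, Nat.cast_one]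
    have hT' : (t : ℝ) ≤ ∑ n ∈ Finset.range (t - 1), ((Set.diagonal Ω)ᶜ).indicator (1 : Ω × Ω → ℝ) (z n) := by
      rw [← hts]; exact hT
    linarith
  calc P.real {z | (t : ℝ) ≤ ∑' n, ((Set.diagonal Ω)ᶜ).indicator (1 : Ω × Ω → ℝ) (z n)}
      ≤ P.real {z | z (t - 1) ∉ Set.diagonal Ω} := by
        simp only [measureReal_def]; exact ENNReal.toReal_mono (measure_ne_top _ _) hsub
    _ = ((fun m : Measure (Ω × Ω) => m.bind Khat)^[t - 1] μ₀).real (Set.diagonal Ω)ᶜ := by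
        rw [hP]; exact crn_chain_offDiagonal_real_eq Khat μ₀ (t - 1)
    _ ≤ (1 - (w x₀)⁻¹) ^ (t - 1) * μ₀.real (Set.diagonal Ω)ᶜ := iterate_bind_crnPair_offDiagonal_le hw hw0 hmax Khat hK (t - 1) μ₀

/-! ## §5 From (cold, off-mode): `E[T] = W` and `E[T²] = W(2W − 1)` exactly -/

/-- **`E[T] = W` EXACTLY** from the coupling (first run at the mode `x₀`, second run never at the mode), atom-free proposal. [ours] -/
theorem crn_chain_integral_totalDisagreement_eq_cold [MeasurableSingletonClass Ω] [MeasurableEq Ω] (hw : Measurable w)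
    (hw0 : ∀ y, 0 < w y) {x₀ : Ω} (hmax : ∀ y, w y ≤ w x₀) [IsProbabilityMeasure (q.withDensity fun y => ENNReal.ofReal (w y))]
    (hq0 : q {x₀} = 0) (Khat : Kernel (Ω × Ω) (Ω × Ω)) [IsMarkovKernel Khat]
    (hK : ∀ z : Ω × Ω, Khat z = (q.prod (volume : Measure unitInterval)).map (fun p : Ω × unitInterval =>
      ((if (p.2 : ℝ) * w z.1 ≤ w p.1 then p.1 else z.1), (if (p.2 : ℝ) * w z.2 ≤ w p.1 then p.1 else z.2))))
    (μ₀ : Measure (Ω × Ω)) [IsProbabilityMeasure μ₀] (hfst : μ₀.map Prod.fst = Measure.dirac x₀)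
    (hsnd : (μ₀.map Prod.snd) {x₀} = 0) :
    ∫ z, (∑' n, ((Set.diagonal Ω)ᶜ).indicator (1 : Ω × Ω → ℝ) (z n))
        ∂(Kernel.trajMeasure (X := fun _ : ℕ => Ω × Ω) μ₀
          (fun n : ℕ => Khat.comap (fun h : (i : ↥(Finset.Iic n)) → Ω × Ω => h ⟨n, Finset.mem_Iic.2 le_rfl⟩)
            (measurable_pi_apply _))) = w x₀ := by
  have hW : 1 ≤ w x₀ := one_le_of_mode (q := q) hmax
  have hWpos : 0 < w x₀ := hw0 x₀
  have hr0 : 0 ≤ 1 - (w x₀)⁻¹ := sub_nonneg.2 (inv_le_one_of_one_le₀ hW)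
  have hr1 : 1 - (w x₀)⁻¹ < 1 := sub_lt_self _ (inv_pos.2 hWpos)
  obtain ⟨-, heq⟩ := crn_chain_integral_totalDisagreement_eq hw hw0 hmax Khat hK μ₀
  rw [heq, tsum_congr fun n => iterate_bind_crnPair_offDiagonal_eq hw hw0 hmax hq0 Khat hK n μ₀ hfst hsnd,
    tsum_geometric_of_lt_one hr0 hr1, sub_sub_cancel, inv_inv]

/-- **`E[T²] = W(2W − 1)` EXACTLY** from (cold, off-mode) with an atom-free proposal (monotone convergence along `T_M ↑ T` and the
exact truncated moments of `…MeetingTimeSharp`); hence `Var T = W(W − 1)`. [ours] -/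
theorem crn_chain_integral_totalDisagreement_sq_eq_cold [MeasurableSingletonClass Ω] [MeasurableEq Ω] [Fact (Measurable w)]
    (hw0 : ∀ y, 0 < w y) {x₀ : Ω} (hmax : ∀ y, w y ≤ w x₀) [IsProbabilityMeasure (q.withDensity fun y => ENNReal.ofReal (w y))]
    (hq0 : q {x₀} = 0) (Khat : Kernel (Ω × Ω) (Ω × Ω)) [IsMarkovKernel Khat]
    (hK : ∀ z : Ω × Ω, Khat z = (q.prod (volume : Measure unitInterval)).map (fun p : Ω × unitInterval =>
      ((if (p.2 : ℝ) * w z.1 ≤ w p.1 then p.1 else z.1), (if (p.2 : ℝ) * w z.2 ≤ w p.1 then p.1 else z.2))))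
    (μ₀ : Measure (Ω × Ω)) [IsProbabilityMeasure μ₀] (hfst : μ₀.map Prod.fst = Measure.dirac x₀)
    (hsnd : (μ₀.map Prod.snd) {x₀} = 0) :
    ∫ z, (∑' n, ((Set.diagonal Ω)ᶜ).indicator (1 : Ω × Ω → ℝ) (z n)) ^ 2
        ∂(Kernel.trajMeasure (X := fun _ : ℕ => Ω × Ω) μ₀
          (fun n : ℕ => Khat.comap (fun h : (i : ↥(Finset.Iic n)) → Ω × Ω => h ⟨n, Finset.mem_Iic.2 le_rfl⟩)
            (measurable_pi_apply _))) = w x₀ * (2 * w x₀ - 1) := by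
  set P := Kernel.trajMeasure (X := fun _ : ℕ => Ω × Ω) μ₀
      (fun n : ℕ => Khat.comap (fun h : (i : ↥(Finset.Iic n)) → Ω × Ω => h ⟨n, Finset.mem_Iic.2 le_rfl⟩)
        (measurable_pi_apply _)) with hP
  have hw : Measurable w := Fact.out
  have hD : MeasurableSet (Set.diagonal Ω) := measurableSet_diagonal
  have hIm : Measurable ((Set.diagonal Ω)ᶜ.indicator (1 : Ω × Ω → ℝ)) := measurable_one.indicator hD.compl
  have hTm : ∀ M, Measurable fun z : ℕ → Ω × Ω =>
      (∑ n ∈ Finset.range M, ((Set.diagonal Ω)ᶜ).indicator (1 : Ω × Ω → ℝ) (z n)) ^ 2 := fun M =>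
    (Finset.measurable_sum _ fun n _ => hIm.comp (measurable_pi_apply n)).pow_const 2
  have hTnn : ∀ M (z : ℕ → Ω × Ω), 0 ≤ ∑ n ∈ Finset.range M, ((Set.diagonal Ω)ᶜ).indicator (1 : Ω × Ω → ℝ) (z n) :=
    fun M z => sum_nonneg fun n _ => Set.indicator_nonneg (fun _ _ => zero_le_one) _
  have hTle : ∀ M (z : ℕ → Ω × Ω), ∑ n ∈ Finset.range M, ((Set.diagonal Ω)ᶜ).indicator (1 : Ω × Ω → ℝ) (z n) ≤ M :=
    fun M z => calc ∑ n ∈ Finset.range M, ((Set.diagonal Ω)ᶜ).indicator (1 : Ω × Ω → ℝ) (z n)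
        ≤ ∑ n ∈ Finset.range M, (1 : ℝ) := sum_le_sum fun n _ => Set.indicator_le_self' (fun _ _ => zero_le_one) _
      _ = M := by rw [sum_const, card_range, nsmul_eq_mul, mul_one]
  have hTi : ∀ M, Integrable (fun z : ℕ → Ω × Ω =>
      (∑ n ∈ Finset.range M, ((Set.diagonal Ω)ᶜ).indicator (1 : Ω × Ω → ℝ) (z n)) ^ 2) P := fun M =>
    integrable_of_bounded P (hTm M) (C := (M : ℝ) ^ 2) (fun z => by
      rw [abs_of_nonneg (sq_nonneg _)]; exact pow_le_pow_left₀ (hTnn M z) (hTle M z) 2)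
  have hI := crn_chain_totalDisagreement_sq_integrable hw0 hmax Khat hK μ₀
  rw [← hP] at hI
  have hmono : ∀ᵐ z ∂P, Monotone fun M => (∑ n ∈ Finset.range M, ((Set.diagonal Ω)ᶜ).indicator (1 : Ω × Ω → ℝ) (z n)) ^ 2 := by
    filter_upwards [crn_chain_ae_tendsto_disagreementCount hw hw0 hmax Khat hK μ₀] with z hz
    exact fun M M' hMM' => pow_le_pow_left₀ (hTnn M z) (hz.1 hMM') 2
  have htend : ∀ᵐ z ∂P, Tendsto (fun M => (∑ n ∈ Finset.range M, ((Set.diagonal Ω)ᶜ).indicator (1 : Ω × Ω → ℝ) (z n)) ^ 2)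
      atTop (𝓝 ((∑' n, ((Set.diagonal Ω)ᶜ).indicator (1 : Ω × Ω → ℝ) (z n)) ^ 2)) := by
    filter_upwards [crn_chain_ae_tendsto_disagreementCount hw hw0 hmax Khat hK μ₀] with z hz
    exact hz.2.pow 2
  have hlim := integral_tendsto_of_tendsto_of_monotone hTi hI hmono htend
  have hlim' := tendsto_integral_disagreementCount_sq_cold hw hw0 hmax hq0 Khat hK μ₀ hfst hsnd
  rw [← hP] at hlim'
  exact tendsto_nhds_unique hlim hlim'

end Summit.Ventures.LatticeQCDFlow.Exactness

end
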